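import Literature.Dynamics.Contraction.AdditiveCompound
import Mathlib.Analysis.SpecialFunctions.Exponential
import Mathlib.Analysis.ODE.Gronwall
import HarnessLib

/-!
# Growth bounds from the logarithmic norm: `‖e^{ta}‖ ≤ e^{t μ(a)}` and `⟪A u, u⟫ ≤ μ(A) ‖u‖²`

Topic `Literature/Dynamics/Contraction`; companion to `AdditiveCompound.lean` (which defines the
logarithmic norm / Lozinskiĭ measure `logNorm a = μ(a) = lim_{h → 0⁺} (‖1 + h a‖ − 1)/h` and proves
subadditivity and `logNorm_le_of_inner_le`), delivering the two growth statements of definition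
request `defn-SecondAdditiveCompound` that are theorems rather than definitions.

**Sources.**  N. V. Kuznetsov, V. Reitmann, *Attractor Dimension Estimates for Dynamical Systems*
(Springer, 2021), §2.4.1: Definition 2.6 (logarithmic / Lozinskiĭ norm
`Λ(A) = lim_{h→0+} (‖I + hA‖ − 1)/h`) and Theorem 2.2 (Lozinskiĭ estimate
`‖Φ(t)‖ ≤ exp ∫₀ᵗ Λ(A(τ)) dτ` for the Cauchy matrix of `v̇ = A(t) v`, proved through the right Dini
derivative `D⁺‖v‖ ≤ Λ(A(t)) ‖v‖`), Proposition 2.17 (`Λ₂(A) = λ₁((A + A^*)/2)`).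
C. Wu, I. Kanevskiy, M. Margaliot, *k-contraction: theory and applications*, arXiv:2008.10321,
§2.4 (matrix measures) and §3 (`μ(J) ≤ -η` gives `|x(t,a) − x(t,b)| ≤ e^{-ηt} |a − b|`).
J. S. Muldowney, Rocky Mountain J. Math. 20 (1990), §2.

**Contents** (namespace `Literature.Dynamics.Contraction`).
* `norm_exp_smul_le_exp_mul_logNorm`: **`‖exp (t a)‖ ≤ e^{t μ(a)}` for `t ≥ 0`** in a complete real
  normed algebra with `‖1‖ = 1` (Dini-derivative Grönwall: `‖e^{(t+h)a}‖ ≤ ‖e^{ha}‖ ‖e^{ta}‖` and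
  `‖e^{ha}‖ ≤ ‖1 + h a‖ + o(h)`, so the right upper derivative of `u(t) = ‖e^{ta}‖` is at most
  `μ(a) u(t)`; then Mathlib's `le_gronwallBound_of_liminf_deriv_right_le`).
* `norm_le_mul_exp_of_logNorm_le`: **the Lozinskiĭ estimate for `v̇ = A(t) v`** with a constant
  bound `μ(A(t)) ≤ ω` on `[0, T)`: `‖v(t)‖ ≤ ‖v(0)‖ e^{ωt}` (Theorem 2.2 with `∫Λ ≤ ωt`), and
  `norm_sub_le_mul_exp_of_logNorm_le` for the difference of two solutions (1-contraction).
* `inner_le_logNorm_mul_norm_sq`: on a real inner product space, `⟪A u, u⟫ ≤ μ(A) ‖u‖²` (the half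
  of `μ₂(A) = sup ⟪A u, u⟫/‖u‖²` converse to `logNorm_le_of_inner_le`), and
  `inner_add_inner_le_two_mul_logNorm`: `⟪A u, u⟫ + ⟪A v, v⟫ ≤ 2 μ(A)` for unit `u, v` — the trace
  condition of `GramArea.gramArea_le_mul_exp_of_orthonormal` with `κ = 2 μ(A)` (Wu–Kanevskiy–Margaliot
  Corollary 1, `p = 2`: 1-contraction implies 2-contraction).

## Mathlib search

`NormedSpace.exp` (field-free, needs a `NormedAlgebra ℚ` structure supplied locally by
`.restrictScalars ℚ ℝ`), `NormedSpace.exp_add_of_commute`, `NormedSpace.exp_continuous`,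
`hasDerivAt_exp_smul_const`, `hasDerivAt_iff_isLittleO`, `hasDerivWithinAt_iff_isLittleO`,
`Asymptotics.IsLittleO.tendsto_div_nhds_zero`, `le_gronwallBound_of_liminf_deriv_right_le`,
`gronwallBound_ε0`.  No logarithmic-norm growth bound in Mathlib or Literature.  No named fact is
introduced; everything below is proved.

## References

* N. V. Kuznetsov, V. Reitmann, *Attractor Dimension Estimates for Dynamical Systems: Theory and
  Computation*, Springer (2021), §2.4.1, Definition 2.6, Theorem 2.2, Proposition 2.17.
  [KuznetsovReitmann2021]
* C. Wu, I. Kanevskiy, M. Margaliot, *k-contraction: theory and applications*, arXiv:2008.10321,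
  §2.4, §3, §3.1 Corollary 1. [WuKanevskiyMargaliot2020]
* J. S. Muldowney, *Compound matrices and ordinary differential equations*, Rocky Mountain J. Math.
  20 (1990) 857–872, §2. [Muldowney1990]
-/

noncomputable section

open scoped Topology InnerProductSpace
open Set Filter Asymptotics

namespace Literature.Dynamics.Contraction

/-! ### The Dahlquist–Lozinskiĭ bound -/

section ExpBound

variable {𝔸 : Type*} [NormedRing 𝔸] [NormedAlgebra ℝ 𝔸] [NormOneClass 𝔸] [CompleteSpace 𝔸]

omit [NormOneClass 𝔸] [CompleteSpace 𝔸] in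
/-- `‖exp (h a)‖ ≤ ‖1 + h a‖ + ‖exp (h a) − 1 − h a‖`. [folklore] -/
theorem norm_exp_smul_le_norm_one_add_add (a : 𝔸) (h : ℝ) :
    ‖NormedSpace.exp (h • a)‖ ≤
      ‖(1 : 𝔸) + h • a‖ + ‖NormedSpace.exp (h • a) - 1 - h • a‖ := by
  have heq : NormedSpace.exp (h • a) = ((1 : 𝔸) + h • a) + (NormedSpace.exp (h • a) - 1 - h • a) := by
    abel
  rw [heq]
  refine (norm_add_le _ _).trans (le_of_eq ?_)
  rw [← heq]

omit [NormOneClass 𝔸] in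
/-- The Taylor remainder `exp (h a) − 1 − h a` is `o(h)` as `h → 0⁺` (the derivative of
`h ↦ exp (h a)` at `0` is `a`). [folklore] -/
theorem tendsto_norm_exp_sub_div (a : 𝔸) :
    Tendsto (fun h : ℝ => ‖NormedSpace.exp (h • a) - 1 - h • a‖ / h) (𝓝[>] 0) (𝓝 0) := by
  have hd := hasDerivAt_exp_smul_const (𝕂 := ℝ) a (0 : ℝ)
  rw [hasDerivAt_iff_isLittleO] at hd
  have hd' : (fun h : ℝ => NormedSpace.exp (h • a) - 1 - h • a) =o[𝓝 (0 : ℝ)] fun h => h := by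
    refine hd.congr' ?_ ?_
    · filter_upwards with h
      rw [zero_smul, NormedSpace.exp_zero, one_mul, sub_zero]
    · filter_upwards with h
      rw [sub_zero]
  exact hd'.norm_left.tendsto_div_nhds_zero.mono_left nhdsWithin_le_nhds

/-- **Dahlquist–Lozinskiĭ bound `‖e^{ta}‖ ≤ e^{t μ(a)}`** (`t ≥ 0`) for an element `a` of a complete
real normed algebra with `‖1‖ = 1` (bounded operators `E →L[ℝ] E`, matrices with an operator norm):
the solution operator of `ẋ = a x` grows at most at the rate given by the logarithmic norm — the
"standard result on contraction" behind every matrix-measure contraction estimate (the autonomous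
case `Φ(t) = e^{ta}` of the Lozinskiĭ estimate).
[cite: KuznetsovReitmann2021, §2.4.1 Theorem 2.2] [cite: WuKanevskiyMargaliot2020, §3] -/
theorem norm_exp_smul_le_exp_mul_logNorm (a : 𝔸) {t : ℝ} (ht : 0 ≤ t) :
    ‖NormedSpace.exp (t • a)‖ ≤ Real.exp (t * logNorm a) := by
  let _ : NormedAlgebra ℚ 𝔸 := .restrictScalars ℚ ℝ 𝔸
  -- `u(s) = ‖exp (s a)‖`, continuous
  set u : ℝ → ℝ := fun s => ‖NormedSpace.exp (s • a)‖ with hu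
  have hcont : Continuous u :=
    continuous_norm.comp (NormedSpace.exp_continuous.comp (continuous_id.smul continuous_const))
  -- the comparison function `g(h) = q_a(h) + ‖R(h)‖/h → μ(a)`
  set g : ℝ → ℝ := fun h => logNormQuot a h + ‖NormedSpace.exp (h • a) - 1 - h • a‖ / h with hg
  have hgt : Tendsto g (𝓝[>] 0) (𝓝 (logNorm a)) := by
    have := (tendsto_logNormQuot a).add (tendsto_norm_exp_sub_div a)
    rwa [add_zero] at this
  -- one-step bound: for `s < z`, `(u z - u s)/(z - s) ≤ g (z - s) * u s`
  have hstep : ∀ s z : ℝ, s < z → (z - s)⁻¹ * (u z - u s) ≤ g (z - s) * u s := by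
    intro s z hz
    have hh : 0 < z - s := sub_pos.mpr hz
    have hsplit : NormedSpace.exp (z • a) =
        NormedSpace.exp ((z - s) • a) * NormedSpace.exp (s • a) := by
      rw [← NormedSpace.exp_add_of_commute (((Commute.refl a).smul_left (z - s)).smul_right s),
        ← add_smul, sub_add_cancel]
    have h1 : u z ≤ ‖NormedSpace.exp ((z - s) • a)‖ * u s := by
      simp only [hu]
      rw [hsplit]
      exact norm_mul_le _ _
    have h2 := norm_exp_smul_le_norm_one_add_add a (z - s)
    have hus : 0 ≤ u s := norm_nonneg _
    have h3 : u z ≤ (‖(1 : 𝔸) + (z - s) • a‖ +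
        ‖NormedSpace.exp ((z - s) • a) - 1 - (z - s) • a‖) * u s :=
      h1.trans (mul_le_mul_of_nonneg_right h2 hus)
    rw [inv_mul_le_iff₀ hh]
    have hgz : (z - s) * (g (z - s) * u s) = (‖(1 : 𝔸) + (z - s) • a‖ - 1 +
        ‖NormedSpace.exp ((z - s) • a) - 1 - (z - s) • a‖) * u s := by
      simp only [hg, logNormQuot]
      field_simp
    rw [hgz]
    linarith
  -- Grönwall with the Dini right derivative `μ(a) u`
  have key := le_gronwallBound_of_liminf_deriv_right_le (f := u) (f' := fun s => logNorm a * u s)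
    (δ := 1) (K := logNorm a) (ε := 0) (a := 0) (b := t) hcont.continuousOn ?_ ?_ ?_
  · have h := key t ⟨ht, le_rfl⟩
    rwa [gronwallBound_ε0, sub_zero, one_mul, mul_comm] at h
  · intro s _ r hr
    -- `g (z - s) * u s → μ(a) u s < r` as `z → s⁺`
    have hsub : Tendsto (fun z : ℝ => z - s) (𝓝[>] s) (𝓝[>] 0) := by
      refine tendsto_nhdsWithin_of_tendsto_nhds_of_eventually_within _ ?_ ?_
      · have : Tendsto (fun z : ℝ => z - s) (𝓝 s) (𝓝 (s - s)) := tendsto_id.sub_const s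
        rw [sub_self] at this
        exact this.mono_left nhdsWithin_le_nhds
      · filter_upwards [self_mem_nhdsWithin] with z hz
        exact mem_Ioi.mpr (sub_pos.mpr (mem_Ioi.mp hz))
    have hT : Tendsto (fun z => g (z - s) * u s) (𝓝[>] s) (𝓝 (logNorm a * u s)) :=
      (hgt.comp hsub).mul_const _
    have hev : ∀ᶠ z in 𝓝[>] s, (z - s)⁻¹ * (u z - u s) < r := by
      filter_upwards [hT.eventually (gt_mem_nhds hr), self_mem_nhdsWithin] with z hz1 hz2
      exact (hstep s z hz2).trans_lt hz1
    exact hev.frequently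
  · simp only [hu, zero_smul, NormedSpace.exp_zero, norm_one, le_refl]
  · intro s _
    simp only [add_zero, le_refl]

/-- **Contraction estimate for the flow**: `‖exp (t A) x‖ ≤ e^{t μ(A)} ‖x‖` for a bounded operator
`A` on a real Banach space and `t ≥ 0`. [cite: WuKanevskiyMargaliot2020, §3] -/
theorem norm_exp_smul_apply_le {E : Type*} [NormedAddCommGroup E] [NormedSpace ℝ E]
    [CompleteSpace E] [Nontrivial E] (A : E →L[ℝ] E) {t : ℝ} (ht : 0 ≤ t) (x : E) :
    ‖NormedSpace.exp (t • A) x‖ ≤ Real.exp (t * logNorm A) * ‖x‖ :=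
  (ContinuousLinearMap.le_opNorm _ _).trans
    (mul_le_mul_of_nonneg_right (norm_exp_smul_le_exp_mul_logNorm A ht) (norm_nonneg _))

end ExpBound

/-! ### Rayleigh quotients are bounded by the logarithmic norm -/

section Hilbert

variable {E : Type*} [NormedAddCommGroup E] [InnerProductSpace ℝ E]

/-- **`⟪A u, u⟫ ≤ μ(A) ‖u‖²`**: the Rayleigh quotients of `A` are bounded by its logarithmic norm
(from `‖u‖² + h ⟪A u, u⟫ = ⟪(1 + hA) u, u⟫ ≤ ‖1 + hA‖ ‖u‖²` for every `h > 0`); with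
`logNorm_le_of_inner_le` this is `μ₂(A) = sup_{u ≠ 0} ⟪A u, u⟫ / ‖u‖² = λ₁((A + Aᵀ)/2)`.
[cite: WuKanevskiyMargaliot2020, §2.4] -/
theorem inner_le_logNorm_mul_norm_sq (A : E →L[ℝ] E) (u : E) :
    ⟪A u, u⟫_ℝ ≤ logNorm A * ‖u‖ ^ 2 := by
  by_cases hu : u = 0
  · subst hu
    simp
  have hu2 : 0 < ‖u‖ ^ 2 := by positivity
  suffices H : ⟪A u, u⟫_ℝ / ‖u‖ ^ 2 ≤ logNorm A by
    rwa [div_le_iff₀ hu2] at H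
  refine le_csInf ⟨_, 1, mem_Ioi.mpr one_pos, rfl⟩ ?_
  rintro _ ⟨h, hh, rfl⟩
  have hh0 : (0 : ℝ) < h := hh
  -- `‖u‖² + h ⟪A u, u⟫ = ⟪(1 + hA) u, u⟫ ≤ ‖1 + hA‖ ‖u‖²`
  have h0 : ((1 : E →L[ℝ] E) + h • A) u = u + h • A u := rfl
  have h1 : ⟪((1 : E →L[ℝ] E) + h • A) u, u⟫_ℝ = ‖u‖ ^ 2 + h * ⟪A u, u⟫_ℝ := by
    rw [h0, inner_add_left, real_inner_smul_left, real_inner_self_eq_norm_sq]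
  have h2 : ⟪((1 : E →L[ℝ] E) + h • A) u, u⟫_ℝ ≤ ‖(1 : E →L[ℝ] E) + h • A‖ * ‖u‖ ^ 2 := by
    calc ⟪((1 : E →L[ℝ] E) + h • A) u, u⟫_ℝ ≤ ‖((1 : E →L[ℝ] E) + h • A) u‖ * ‖u‖ :=
          real_inner_le_norm _ _
      _ ≤ ‖(1 : E →L[ℝ] E) + h • A‖ * ‖u‖ * ‖u‖ := by
          gcongr
          exact ContinuousLinearMap.le_opNorm _ _
      _ = ‖(1 : E →L[ℝ] E) + h • A‖ * ‖u‖ ^ 2 := by ring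
  rw [h1] at h2
  -- divide by `h ‖u‖²`
  unfold logNormQuot
  rw [div_le_div_iff₀ hu2 hh0]
  nlinarith [h2]

/-- **1-contraction implies 2-contraction**: for unit vectors `u, v`,
`⟪A u, u⟫ + ⟪A v, v⟫ ≤ 2 μ(A)`, so a logarithmic-norm bound `μ(A(t)) ≤ ω` gives the trace
condition of `gramArea_le_mul_exp_of_orthonormal` with `κ = 2ω` (graded structure,
Wu–Kanevskiy–Margaliot Corollary 1 for `p = 2`). [cite: WuKanevskiyMargaliot2020, §3.1 Corollary 1] -/
theorem inner_add_inner_le_two_mul_logNorm (A : E →L[ℝ] E) {u v : E} (hu : ‖u‖ = 1)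
    (hv : ‖v‖ = 1) : ⟪A u, u⟫_ℝ + ⟪A v, v⟫_ℝ ≤ 2 * logNorm A := by
  have h1 := inner_le_logNorm_mul_norm_sq A u
  have h2 := inner_le_logNorm_mul_norm_sq A v
  rw [hu, one_pow, mul_one] at h1
  rw [hv, one_pow, mul_one] at h2
  linarith

end Hilbert

/-! ### The Lozinskiĭ estimate for `ẋ = A(t) x` -/

section TimeVarying

variable {E : Type*} [NormedAddCommGroup E] [NormedSpace ℝ E] [Nontrivial E]

/-- **Lozinskiĭ estimate (time-varying, constant bound)**: if `v` solves `v̇ = A(t) v` on `[0, T)`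
(right derivatives, `v` continuous on `[0, T]`) and `μ(A(t)) ≤ ω` there, then
`‖v(t)‖ ≤ ‖v(0)‖ e^{ωt}` on `[0, T]` — the right Dini derivative of `n(t) = ‖v(t)‖` satisfies
`D⁺n ≤ μ(A(t)) n` because `‖v + h A v‖ ≤ ‖1 + h A‖ ‖v‖`.  (Kuznetsov–Reitmann prove
`‖Φ(t)‖ ≤ exp ∫₀ᵗ Λ(A(τ)) dτ`; with `Λ(A(τ)) ≤ ω` this is the displayed bound, which is the form used
for contraction: `μ(J) ≤ -η ⇒ |x(t,a) − x(t,b)| ≤ e^{-ηt}|a − b|`.)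
[cite: KuznetsovReitmann2021, §2.4.1 Theorem 2.2] [cite: WuKanevskiyMargaliot2020, §3] -/
theorem norm_le_mul_exp_of_logNorm_le {A : ℝ → E →L[ℝ] E} {v : ℝ → E} {ω T : ℝ}
    (hvc : ContinuousOn v (Icc 0 T))
    (hv : ∀ t ∈ Ico 0 T, HasDerivWithinAt v (A t (v t)) (Ici t) t)
    (hA : ∀ t ∈ Ico 0 T, logNorm (A t) ≤ ω) :
    ∀ t ∈ Icc 0 T, ‖v t‖ ≤ ‖v 0‖ * Real.exp (ω * t) := by
  have hcont : ContinuousOn (fun s => ‖v s‖) (Icc 0 T) := hvc.norm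
  have key := le_gronwallBound_of_liminf_deriv_right_le (f := fun s => ‖v s‖)
    (f' := fun s => logNorm (A s) * ‖v s‖) (δ := ‖v 0‖) (K := ω) (ε := 0) (a := 0) (b := T)
    hcont ?_ le_rfl ?_
  · intro t ht
    have h := key t ht
    rwa [gronwallBound_ε0, sub_zero] at h
  · intro t ht r hr
    -- Taylor remainder `R z = v z - v t - (z - t) • A (v t)` is `o(z - t)` from the right
    have hR : Tendsto (fun z => ‖v z - v t - (z - t) • A t (v t)‖ / (z - t)) (𝓝[>] t) (𝓝 0) := by
      have h := (hv t ht)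
      rw [hasDerivWithinAt_iff_isLittleO] at h
      exact h.norm_left.tendsto_div_nhds_zero.mono_left (nhdsWithin_mono _ Ioi_subset_Ici_self)
    -- the comparison `q(z - t) ‖v t‖ + ‖R z‖/(z - t) → μ(A t) ‖v t‖`
    have hsub : Tendsto (fun z : ℝ => z - t) (𝓝[>] t) (𝓝[>] 0) := by
      refine tendsto_nhdsWithin_of_tendsto_nhds_of_eventually_within _ ?_ ?_
      · have : Tendsto (fun z : ℝ => z - t) (𝓝 t) (𝓝 (t - t)) := tendsto_id.sub_const t
        rw [sub_self] at this
        exact this.mono_left nhdsWithin_le_nhds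
      · filter_upwards [self_mem_nhdsWithin] with z hz
        exact mem_Ioi.mpr (sub_pos.mpr (mem_Ioi.mp hz))
    have hT : Tendsto (fun z => logNormQuot (A t) (z - t) * ‖v t‖ +
        ‖v z - v t - (z - t) • A t (v t)‖ / (z - t)) (𝓝[>] t) (𝓝 (logNorm (A t) * ‖v t‖)) := by
      have := (((tendsto_logNormQuot (A t)).comp hsub).mul_const ‖v t‖).add hR
      rwa [add_zero] at this
    -- pointwise bound of the slope for `z > t`
    have hstep : ∀ z, t < z → (z - t)⁻¹ * (‖v z‖ - ‖v t‖) ≤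
        logNormQuot (A t) (z - t) * ‖v t‖ + ‖v z - v t - (z - t) • A t (v t)‖ / (z - t) := by
      intro z hz
      have hh : 0 < z - t := sub_pos.mpr hz
      have h1 : ‖v z‖ ≤ ‖((1 : E →L[ℝ] E) + (z - t) • A t) (v t)‖ +
          ‖v z - v t - (z - t) • A t (v t)‖ := by
        have heq : v z = ((1 : E →L[ℝ] E) + (z - t) • A t) (v t) +
            (v z - v t - (z - t) • A t (v t)) := by
          have h0 : ((1 : E →L[ℝ] E) + (z - t) • A t) (v t) = v t + (z - t) • A t (v t) := rfl
          rw [h0]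
          abel
        rw [heq]
        refine (norm_add_le _ _).trans (le_of_eq ?_)
        rw [← heq]
      have h2 : ‖((1 : E →L[ℝ] E) + (z - t) • A t) (v t)‖ ≤
          ‖(1 : E →L[ℝ] E) + (z - t) • A t‖ * ‖v t‖ := ContinuousLinearMap.le_opNorm _ _
      rw [inv_mul_le_iff₀ hh]
      have hq : (z - t) * (logNormQuot (A t) (z - t) * ‖v t‖ +
          ‖v z - v t - (z - t) • A t (v t)‖ / (z - t)) =
          (‖(1 : E →L[ℝ] E) + (z - t) • A t‖ - 1) * ‖v t‖ + ‖v z - v t - (z - t) • A t (v t)‖ := by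
        unfold logNormQuot
        field_simp
      rw [hq]
      linarith
    have hev : ∀ᶠ z in 𝓝[>] t, (z - t)⁻¹ * (‖v z‖ - ‖v t‖) < r := by
      filter_upwards [hT.eventually (gt_mem_nhds hr), self_mem_nhdsWithin] with z hz1 hz2
      exact (hstep z hz2).trans_lt hz1
    exact hev.frequently
  · intro t ht
    have h := mul_le_mul_of_nonneg_right (hA t ht) (norm_nonneg (v t))
    linarith

/-- **Contraction of differences**: two solutions `x, y` of the same linear equation `ẋ = A(t) x`
with `μ(A(t)) ≤ ω` satisfy `‖x(t) − y(t)‖ ≤ ‖x(0) − y(0)‖ e^{ωt}`.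
[cite: WuKanevskiyMargaliot2020, §3] -/
theorem norm_sub_le_mul_exp_of_logNorm_le {A : ℝ → E →L[ℝ] E} {x y : ℝ → E} {ω T : ℝ}
    (hxc : ContinuousOn x (Icc 0 T)) (hyc : ContinuousOn y (Icc 0 T))
    (hx : ∀ t ∈ Ico 0 T, HasDerivWithinAt x (A t (x t)) (Ici t) t)
    (hy : ∀ t ∈ Ico 0 T, HasDerivWithinAt y (A t (y t)) (Ici t) t)
    (hA : ∀ t ∈ Ico 0 T, logNorm (A t) ≤ ω) :
    ∀ t ∈ Icc 0 T, ‖x t - y t‖ ≤ ‖x 0 - y 0‖ * Real.exp (ω * t) :=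
  fun t ht =>
    norm_le_mul_exp_of_logNorm_le (v := x - y) (hxc.sub hyc)
      (fun s hs => ((hx s hs).sub (hy s hs)).congr_deriv (by rw [Pi.sub_apply, map_sub])) hA t ht

end TimeVarying

end Literature.Dynamics.Contraction
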